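import Mathlib.Probability.UniformOn
import Mathlib.Probability.Moments.Variance
import Mathlib.Probability.Independence.Basic
import HarnessLib

/-!
# Majority vote over independent uniform trials (weak law of large numbers, Chebyshev form)

Trunk T-CPLX-CORE (Literature/Computability/Complexity). The counting form of the estimate by
which Blum–Micali "concentrate a stochastic advantage" (1984, §3.3, the Weak Law of Large
Numbers quoted before Lemma 2: for `k` independent `0`-`1` variables equal to `1` with
probability `α` and `S_k` their sum, `k ≥ 1/(4φψ²)` implies `Pr(|S_k/k - α| > ψ) < φ`), in the
shape used by majority-vote amplification arguments over a finite uniform sample space: if a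
`≥ 1/2 + η` fraction of the outcomes of one trial is good, then among the `|α|^m` outcome
sequences of `m` trials at most `|α|^m/(4 m η²)` fail to have a strict majority of good trials
(`card_majority_fail_mul_le`), hence at most a `δ` fraction once `m ≥ 1/(4 δ η²)`
(`card_majority_fail_le`). Written for the discharge plan of
`Literature.Computability.Cryptography.blumMicali_halfPredicate_dlog` (see `Cryptography/BlumMicaliReduction.lean`), but
independent of it.

Proof: Mathlib's Chebyshev inequality `ProbabilityTheory.meas_ge_le_variance_div_sq` for the
number of good trials under the product of uniform measures (`ProbabilityTheory.uniformOn_pi`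
identifies it with the uniform measure on sequences), whose variance is the sum of the
one-trial variances (`ProbabilityTheory.variance_sum_pi`), each `≤ 1/4` (Bhatia–Davis,
`ProbabilityTheory.variance_le_sub_mul_sub`). Inside the proof the finite outcome type is given
the discrete measurable structure `⊤`; the statements are pure counting.

## References

* M. Blum, S. Micali, *How to generate cryptographically strong sequences of pseudo-random
  bits*, SIAM J. Comput. 13 (1984), §3.3 (Weak Law of Large Numbers; Lemma 2,
  `trials(ψ, φ) = 1/(4φψ²)`); FOCS 1982 version p. 115.
* E. Kranakis, *Primality and Cryptography*, Wiley–Teubner 1986, §3.5: Lemma 3.1 (Chebyshev's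
  inequality), Thm. 3.5 (Weak Law of Large Numbers, Bernoulli, `≤ 1/(4nε²)`); §4.10, proof of
  Thm. 4.20 ("using the weak law of large numbers").
* Mathlib: `ProbabilityTheory.meas_ge_le_variance_div_sq`, `variance_sum_pi`, `uniformOn_pi`.
-/

noncomputable section

namespace Literature.Computability.Complexity

open MeasureTheory ProbabilityTheory Finset

/-- **Weak law of large numbers for a majority vote (Chebyshev form, counting version).**
Let `α` be a finite nonempty set of outcomes of one trial, of which at least a `1/2 + η`
fraction (`η > 0`) are good. Among the `|α|^m` outcome sequences of `m ≥ 1` independent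
uniform trials, those in which the good outcomes are *not* a strict majority
(`2 · #{i | good (ω i)} ≤ m`) number at most `|α|^m / (4 m η²)`. (Chebyshev: the number of good
trials has mean `≥ m(1/2 + η)` and variance `≤ m/4`.) This is Kranakis's Theorem 3.5 (Weak
Law of Large Numbers, Bernoulli: `Pr[|F_n(E) - p| ≥ ε] ≤ p(1-p)/(nε²) ≤ 1/(4nε²)`) applied to
the event "good", and the "trials(ψ, φ) = 1/(4φψ²)" estimate quoted by Blum–Micali.
[Kranakis 1986, Thm. 3.5; Blum–Micali 1984, §3.3 (Weak Law of Large Numbers, before Lemma 2)]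
[cite: Kranakis1986, Thm. 3.5] -/
theorem card_majority_fail_mul_le {α : Type*} [Fintype α] [Nonempty α]
    (good : α → Prop) [DecidablePred good] {m : ℕ} (hm : 0 < m) {η : ℝ} (hη : 0 < η)
    (hgood : (1 / 2 + η) * Fintype.card α ≤ (univ.filter good).card) :
    ((univ.filter fun ω : Fin m → α => 2 * (univ.filter fun i => good (ω i)).card ≤ m).card : ℝ)
        * (4 * m * η ^ 2) ≤ Fintype.card (Fin m → α) := by
  classical
  letI : MeasurableSpace α := ⊤
  haveI : MeasurableSingletonClass α := ⟨fun _ => MeasurableSpace.measurableSet_top⟩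
  -- one trial: the uniform measure on `α`, and the indicator `X` of a good outcome
  set μ : Measure α := uniformOn (Set.univ : Set α) with hμ
  set X : α → ℝ := fun a => if good a then 1 else 0 with hX
  have hXmeas : Measurable X := measurable_of_finite X
  have hXbdd : ∀ᵐ a ∂μ, X a ∈ Set.Icc (0 : ℝ) 1 :=
    ae_of_all _ fun a => by simp only [hX]; split_ifs <;> simp
  have hXLp : MemLp X 2 μ := memLp_of_bounded hXbdd hXmeas.aestronglyMeasurable 2
  -- its mean is the good fraction `≥ 1/2 + η`
  have hmean : (1 / 2 + η : ℝ) ≤ μ[X] := by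
    have hcard : (0 : ℝ) < Fintype.card α := by exact_mod_cast Fintype.card_pos
    rw [integral_fintype (MemLp.integrable (by norm_num) hXLp)]
    have hsing : ∀ a : α, μ.real {a} = (Fintype.card α : ℝ)⁻¹ := fun a => by
      rw [measureReal_def, hμ, uniformOn_univ, Measure.count_singleton]
      simp [ENNReal.toReal_inv]
    simp only [hsing, smul_eq_mul, ← Finset.mul_sum]
    rw [show ∑ a : α, X a = ((univ.filter good).card : ℝ) by
      rw [Finset.natCast_card_filter]]
    rw [inv_mul_eq_div, le_div_iff₀ hcard]
    exact hgood
  -- its variance is at most `1/4`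
  have hvar : Var[X; μ] ≤ 1 / 4 := by
    have h := variance_le_sub_mul_sub hXbdd hXmeas.aemeasurable
    nlinarith [h, sq_nonneg (μ[X] - 1 / 2)]
  -- `m` independent trials: the product measure, and the number `S` of good trials
  set P : Measure (Fin m → α) := Measure.pi fun _ : Fin m => μ with hP
  have hPunif : uniformOn (Set.univ : Set (Fin m → α)) = P := by
    rw [hP, ← uniformOn_pi, Set.pi_univ]
  set S : (Fin m → α) → ℝ := ∑ i : Fin m, fun ω => X (ω i) with hS
  have hSLp : MemLp S 2 P := by
    refine memLp_finsetSum' _ fun i _ => ?_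
    exact hXLp.comp_measurePreserving (measurePreserving_eval (fun _ : Fin m => μ) i)
  have hSvar : Var[S; P] ≤ m / 4 := by
    rw [hS, hP, variance_sum_pi fun _ => hXLp]
    calc ∑ _i : Fin m, Var[X; μ] ≤ ∑ _i : Fin m, (1 / 4 : ℝ) := Finset.sum_le_sum fun i _ => hvar
      _ = m / 4 := by
          simp only [Finset.sum_const, Finset.card_univ, Fintype.card_fin]; ring
  have hSmean : (m : ℝ) * (1 / 2 + η) ≤ P[S] := by
    have hint : ∀ i : Fin m, ∫ ω, X (ω i) ∂P = μ[X] := fun i => by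
      have hmp := measurePreserving_eval (fun _ : Fin m => μ) i
      rw [← hmp.map_eq, integral_map (measurable_pi_apply i).aemeasurable
        hXmeas.aestronglyMeasurable]
    have : P[S] = ∑ i : Fin m, ∫ ω, X (ω i) ∂P := by
      rw [hS, ← integral_finsetSum _ fun i _ => ?_]
      · simp only [Finset.sum_apply]
      · exact MemLp.integrable (by norm_num)
          (hXLp.comp_measurePreserving (measurePreserving_eval (fun _ : Fin m => μ) i))
    rw [this]
    simp only [hint, Finset.sum_const, Finset.card_univ, Fintype.card_fin, nsmul_eq_mul]
    exact mul_le_mul_of_nonneg_left hmean (by positivity)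
  -- the failure event lies inside the Chebyshev tail `{m η ≤ |S - E S|}`
  set B : Finset (Fin m → α) :=
    univ.filter fun ω : Fin m → α => 2 * (univ.filter fun i => good (ω i)).card ≤ m with hB
  have hSval : ∀ ω, S ω = ((univ.filter fun i => good (ω i)).card : ℝ) := fun ω => by
    rw [hS, Finset.natCast_card_filter, Finset.sum_apply]
  have hsub : (B : Set (Fin m → α)) ⊆ {ω | (m : ℝ) * η ≤ |S ω - P[S]|} := by
    intro ω hω
    rw [Finset.mem_coe, hB, Finset.mem_filter] at hω
    have h2 : 2 * ((univ.filter fun i => good (ω i)).card : ℝ) ≤ m := by exact_mod_cast hω.2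
    have hmη : (0 : ℝ) ≤ m * η := by positivity
    rw [Set.mem_setOf_eq, hSval ω, abs_sub_comm, abs_of_nonneg (by linarith)]
    linarith
  have hcheb := meas_ge_le_variance_div_sq hSLp (c := (m : ℝ) * η) (by positivity)
  have hPB : P B ≤ ENNReal.ofReal (1 / (4 * m * η ^ 2)) := by
    refine ((measure_mono hsub).trans hcheb).trans (ENNReal.ofReal_le_ofReal ?_)
    rw [div_le_div_iff₀ (by positivity) (by positivity)]
    have hm' : (1 : ℝ) ≤ m := by exact_mod_cast hm
    nlinarith [hSvar, sq_nonneg η, mul_pos (show (0:ℝ) < m by positivity) (sq_pos_of_pos hη)]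
  -- read the product measure of `B` as a proportion
  have hPB' : P B = (B.card : ENNReal) / Fintype.card (Fin m → α) := by
    rw [← hPunif, uniformOn_univ, Measure.count_apply_finset]
  rw [hPB'] at hPB
  have hN : (0 : ℝ) < Fintype.card (Fin m → α) := by exact_mod_cast Fintype.card_pos
  have hreal : (B.card : ℝ) / Fintype.card (Fin m → α) ≤ 1 / (4 * m * η ^ 2) := by
    have := ENNReal.toReal_mono ENNReal.ofReal_ne_top hPB
    rwa [ENNReal.toReal_div, ENNReal.toReal_ofReal (by positivity), ENNReal.toReal_natCast,
      ENNReal.toReal_natCast] at this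
  rw [div_le_div_iff₀ hN (by positivity), one_mul] at hreal
  exact hreal

/-- **Majority vote, `δ` form.** With `m ≥ 1/(4 δ η²)` trials, at most a `δ` fraction of the
outcome sequences fail to have a strict majority of good trials — Blum–Micali's
`trials(ψ, φ) = 1/(4φψ²)`. [Blum–Micali 1984, §3.3 (Weak Law of Large Numbers; Lemma 2);
Kranakis 1986, Thm. 3.5] [cite: BlumMicali1984, §3.3 Lemma 2] -/
theorem card_majority_fail_le {α : Type*} [Fintype α] [Nonempty α]
    (good : α → Prop) [DecidablePred good] {m : ℕ} {η δ : ℝ} (hη : 0 < η) (hδ : 0 < δ)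
    (hm : 1 / (4 * δ * η ^ 2) ≤ m)
    (hgood : (1 / 2 + η) * Fintype.card α ≤ (univ.filter good).card) :
    ((univ.filter fun ω : Fin m → α => 2 * (univ.filter fun i => good (ω i)).card ≤ m).card : ℝ)
      ≤ δ * Fintype.card (Fin m → α) := by
  have hmpos : 0 < m := by
    rcases Nat.eq_zero_or_pos m with rfl | h
    · exfalso
      have : (0 : ℝ) < 1 / (4 * δ * η ^ 2) := by positivity
      rw [Nat.cast_zero] at hm
      linarith
    · exact h
  have h := card_majority_fail_mul_le good hmpos hη hgood
  set N := (Fintype.card (Fin m → α) : ℝ)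
  set b := (((univ.filter fun ω : Fin m → α =>
    2 * (univ.filter fun i => good (ω i)).card ≤ m).card : ℕ) : ℝ)
  have hb : 0 ≤ b := by positivity
  -- `1 ≤ 4 δ η² m`, so `b ≤ b · 4 m η² · δ ≤ N δ`
  have h1 : 1 ≤ 4 * δ * η ^ 2 * m := by
    rwa [div_le_iff₀ (by positivity), mul_comm] at hm
  calc b = b * 1 := (mul_one b).symm
    _ ≤ b * (4 * δ * η ^ 2 * m) := mul_le_mul_of_nonneg_left h1 hb
    _ = b * (4 * m * η ^ 2) * δ := by ring
    _ ≤ N * δ := mul_le_mul_of_nonneg_right h hδ.le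
    _ = δ * N := mul_comm _ _

end Literature.Computability.Complexity

end
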